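import Summits.QuantumFields.YangMills.Theorems.BalabanUVNodesK0AxTangentSocketDock

/-!
# NODE O · K0ᴬ — THE TANGENT SOCKET, LOCAL (v1.1) SUBMERSION LETTER: the level set of `Ψ` lies in the fibre only NEAR each member — the form n07-e's canonical logarithmic chart
# `Node00.msChart` has (`IsFibreChartNear`, ✓`isFibreChartNear_msChart`) — and the (R-a) chain (N12 §3 ⟶ tangent form ⟶ socket ⟶ rooted receipts + TokP9reg♭ᵣ) re-run on it
# (FILE 7 of the «rooting is a gradient at first order» cut; consumes ✓`…K0AxTangentSocketDock` (§4c–§4e) by name)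

LANDING NOTE (porter ▶ PTC-1 g4, 2026-08-31; AUTHORSHIP = ◇ lens-1 g11 «cauchy-analytic», HOME sketch `nodeO-cover/LENS-1g11-TangentSocketNear-v1.lean` sha16 f8db40df3e7ac862 · 259 l. · 1 def + 8
thm · 0 sorry (CANDIDATE 5 = FILE 7: the LOCAL submersion letter ∕ `…NearAt` family token — the WEAKER edition n07-e's canonical `msChart` can inhabit, with a bridge from the global §4b token;
both citable)): landed VERBATIM (only this paragraph added) as the NEW LEAF ◆ named (`…Theorems/BalabanUVNodesK0AxTangentSocketNear.lean`), INTENT-60, after ✓p821981 (the §4d+§4e APPEND to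
`…K0AxTangentSocketDock`); `--supports stmt-QuantumFields-27238 --as helper` (NO `--workitem`; kind definition — one displayed Prop-def); ◆ CRIT-1 g37's cut (its ■ SEAT-CLOSE line, nodeO STATUS
2026-08-31T11:45:16Z): «CANDIDATE 5 — SAME-WALL: SURVIVES (priced lower: it WEAKENS a displayed letter, robustness, no new claim about Bałaban); J1′ ∕ J4 ∕ J5′ ∕ (Q-ord) STAMP PASS; CUT GO as
INTENT-60 = NEW LEAF, KEEP the GLOBAL §4b token as is».  HONEST (porter): topology ∕ bookkeeping + N12's machine re-run with a localised level-set clause; CONDITIONAL over DISPLAYED letters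
inhabited NOWHERE; (C-tab-opt) STRUCK; nothing of Bałaban asserted, ported, discharged or refuted; K0ᴬ stmt-QuantumFields-27238 ∕ K0⁷ 20541 OPEN — NOTHING of them proved; NODE O 0∕1; COUNT 8∕28 ·
K 1∕4 UNMOVED; finite 𝕋⁴ at fixed ε — NOT continuum ∕ OS ∕ Clay; the Yang–Mills mass gap is NOT proved by any of this.

◇ `ymgap-nodeO-lens-1` g11 (planner; typed for the porter ▶ PTC-1; proposed basename `…/Theorems/BalabanUVNodesK0AxTangentSocketNear.lean`,
`--supports stmt-QuantumFields-27238 --as helper`).  Items: K0ᴬ stmt-QuantumFields-27238 OPEN; K0⁷ stmt-QuantumFields-20541 OPEN.  [15] = [Balaban1985Variational],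
[RS] = [Balaban1985RegularSpaces], [I] = [Balaban1987RG1], [III] = [Balaban1988Convergent].

WHY.  The of-record family token ✓`FlatCritOnFibreExpChartFamilyAt` (§4b) carries n07-e's submersion letter with the GLOBAL level-set clause «`∀ Y, Ψ Y = Ψ (X B) → expChart 1 Y ∈ 𝔅(𝐁, W B)`»
(VERBATIM the `hchart` binder of N12's ✓`fderiv_minimiserExpChartFamily_eq_linearisedMinimiser_class6`, print's `IsFibreChartAt` shape).  n07-e's own v1.1 (`Node00.IsFibreChartNear`,
✓`hasDerivAt_wilsonAction4_expChart_of_isCritOnFibre_near`, and its Fréchet form ✓`Node00.fderiv_wilsonAction4_expChart_apply_eq_zero_of_isCritOnFibre_near` for a chart CENTRED at the member) records that the CANONICAL chart — the logarithmic chart of the averages `π(log(W* · Ū^j(U·exp X)))`, ✓`Node00.msChart` — satisfies the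
level-set clause only NEAR the centre («a logarithmic chart is injective only near the identity»); a global clause is an avoidable obstruction to inhabiting the token.  This file replaces it by
the LOCAL clause «`∀ᶠ Y in 𝓝 (X B), Ψ Y = Ψ (X B) → expChart 1 Y ∈ 𝔅(𝐁, W B)`» throughout: N12 §3's implicit-function curve through `X B` is continuous at `0`, so it lies where the local clause
holds — nothing else in the chain sees the difference.  After this file the `Ψ`-letter displayed on the (R-a) road at def-Y's chart is: strict derivative ONTO at every member near `0`, local
level sets in the one-scale fibres, `DΨ` differentiable at `0` — inhabitable by ONE `B`-independent logarithmic chart of the level-`(k+1)` averages against the flat reference.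

WHAT IS PROVED (kernel, sorry-free, standard axioms; namespace `K0AxCtabUniq`, section `NearEdition`).
★★★ `fderiv_wilsonAction4_expChart_apply_eq_zero_of_isCritOnFibre_levelNear` (generic `N`, any base `U₀`, AT A MEMBER `X₁` of a chart based at `U₀` — N12 §3 with the local level-set clause; n07-e's
`Node00.…_near` is the edition for a chart CENTRED at the configuration, derivative at `0`); `eventually_levelSet_of_forall` (global ⟹ local);
`eventually_nhds_eventually_nhds_of_prod` (topology bookkeeping for suppliers: a property near `(X g₀, g₀)` holds, for `g` near `g₀`, for all `Y` near `X g`); displayed letter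
`FlatCritOnFibreExpChartFamilyNearAt` (the of-record family token with the LOCAL clause); `flatCritOnFibreExpChartFamilyNearAt_of_global` (v1.1 is WEAKER);
★★ `flatCriticalExpChartFamilyAt_of_critOnFibreNear` (local token ⟹ tangent-form token ✓`FlatCriticalExpChartFamilyAt`); ★★★ `chartResponseWeaklyCritical_of_critOnFibreNearFamily` (local token +
(J-crit′) + (J-cons′) ⟹ `ChartResponseWeaklyCriticalAt`, all `a l`); ★★★ `rootedReceipts_of_flatExpChartFamily` (the most general docking: ANY factorising chart, (s-exp), the TANGENT-FORM token,
the two dictionaries ⟹ the four rooted receipts); ★★★ `rootedReceipts_of_tokens_atScale_near` (KNIT tokens + (s-exp) + `X 0 = 0`, `X` C² + LOCAL `Ψ`-letter + datum clause + (J-crit′) + (J-cons′)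
⟹ (∀ a l, four receipts) ∧ TokP9reg♭ᵣ; minimality from the KNIT by ✓`eventually_isCritOnFibre_expChart_of_tokens`).

HONEST.  Calculus + logic (one implicit-function curve, inherited from n07-e's ✓`exists_hasDerivAt_curve_of_mem_ker`); CONDITIONAL theorems over DISPLAYED letters inhabited NOWHERE; nothing
of Bałaban ([15] Thm 1, Prop. 3, Prop. 6–9, (82)–(83), (176)–(178); [RS] (1.113)–(1.114); [III] (2.12); [I] (0.21), (1.1)–(1.2)) is asserted, ported or discharged; (C-tab-opt) stays STRUCK;
K0ᴬ 27238 ∕ K0⁷ 20541 OPEN — NOTHING of them proved; NODE O 0∕1; COUNT 8∕28 · K 1∕4 UNMOVED; finite 𝕋⁴_{L^K} at fixed ε — NOT continuum ∕ OS ∕ Clay; **the Yang–Mills mass gap is NOT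
proved by any of this.**  No `sorry`, no `instance ∕ notation ∕ set_option`; standard axioms.
-/

noncomputable section

open Filter Topology
open scoped BigOperators Matrix.Norms.L2Operator

namespace Summit.QuantumFields.YangMills.Theorems.K0AxCtabUniq

open Literature.MathematicalPhysics.QuantumFieldTheory.Balaban1983to89
open LatticeFieldCalculus B6SectADomainsV1 B6SectAOperatorsV1 B6SectAVectorModelV1 B6SectACriticalPointV1
open Literature.MathematicalPhysics.QuantumFieldTheory.Balaban1983to89.T4Continuum (T4Family)
open Literature.MathematicalPhysics.QuantumFieldTheory.Balaban1983to89.Node00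
open T4RootedResidualGauge (rootGauge)
open GaugeField (gaugeAct)
open B12GaugeOrbits021 (IsResidual OrbitRel)
open B11Prop6Scheme (mapT)
open Summit.QuantumFields.YangMills.Theorems.K0RecordFormatNames
open Summit.QuantumFields.YangMills.Theorems.K0AxRootGrad

variable (F : T4Family) (θ : Stage13Params F 2)


/-! ### §4f  THE LOCAL (v1.1) EDITION OF THE SUBMERSION LETTER: level sets of `Ψ` lie in the fibres only NEAR each member — the form n07-e's canonical logarithmic chart
`msChart` satisfies (`Node00.IsFibreChartNear`, ✓`isFibreChartNear_msChart`) — and the whole (R-a) chain re-run on it -/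

section NearEdition

open Literature.MathematicalPhysics.QuantumFieldTheory.Balaban1983to89.B11Eq177CriticalFamilyDerivative (contDiff_wilsonAction4_expChart)
open T4AdjointCovarianceUnitary (lieSU expSU coe_expSU)
open B15DeterminingSets (DetSet MSField AgreeOn avgFamily IsMinimizer atScale isMinimizer_atScale_iff)

/-- ★★★ **N12 §3 WITH THE LOCAL LEVEL-SET CLAUSE (v1.1)**: as ✓`fderiv_wilsonAction4_expChart_apply_eq_zero_of_isCritOnFibre`, but the level set of `Ψ` through `X₁` is required to
lie in the fibre only for `Y` NEAR `X₁` (`∀ᶠ Y in 𝓝 X₁, Ψ Y = Ψ X₁ → U₀·exp Y ∈ 𝔅(𝐁, W)`) — the form a LOGARITHMIC chart of the constraint satisfies (n07-e's `IsFibreChartNear`,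
✓`isFibreChartNear_msChart`: «a logarithmic chart is injective only near the identity»).  The implicit-function curve `c` through `X₁` is continuous at `0`, so for small `s` it lies
where the clause holds; the rest is N12's proof verbatim. [cite: Balaban1985Variational, (5)–(6) p.278, Sect. C (47) p.285, Prop. 3 p.289, (82)–(83) p.290, Prop. 8 p.304; Balaban1985RegularSpaces, (1.113)–(1.114) pp.95–97; Balaban1988Convergent, (2.10)–(2.12) p.256] -/
theorem fderiv_wilsonAction4_expChart_apply_eq_zero_of_isCritOnFibre_levelNear {N : ℕ} [NeZero N] {K : ℕ} {𝔹 : DetSet (F.P K)}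
    {W : MSField (F.P K) (SU N)} (U₀ : GaugeField (F.P K) 0 (SU N)) {V : Type*} [NormedAddCommGroup V] [NormedSpace ℝ V] [FiniteDimensional ℝ V]
    {Ψ : (PBond (F.P K) 0 → lieSU (Fin N)) → V} {Ψ' : (PBond (F.P K) 0 → lieSU (Fin N)) →L[ℝ] V} {X₁ : PBond (F.P K) 0 → lieSU (Fin N)}
    (hΨ : HasStrictFDerivAt Ψ Ψ' X₁) (hon : (Ψ' : (PBond (F.P K) 0 → lieSU (Fin N)) →ₗ[ℝ] V).range = ⊤)
    (hlev : ∀ᶠ Y in 𝓝 X₁, Ψ Y = Ψ X₁ → AgreeOn 𝔹 (avgFamily (avOfRecord F N K) (expChart U₀ Y)) W)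
    (hcrit : IsCritOnFibre F N K 𝔹 W (expChart U₀ X₁)) {t : PBond (F.P K) 0 → lieSU (Fin N)} (ht : Ψ' t = 0) :
    fderiv ℝ (fun Y : PBond (F.P K) 0 → lieSU (Fin N) => wilsonAction4 (expChart U₀ Y)) X₁ t = 0 := by
  haveI : @CompleteSpace (lieSU (Fin N)) (@PseudoMetricSpace.toUniformSpace _
      (T4AdjointCovarianceUnitary.instSeminormedAddCommGroupLieSU (n := Fin N)).toPseudoMetricSpace) :=
    complete_of_proper
  obtain ⟨c, hc0, hct, hcf⟩ := exists_hasDerivAt_curve_of_mem_ker hΨ hon ht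
  have hγ0 : (fun s => expChart U₀ (c s)) 0 = expChart U₀ X₁ := by
    show expChart U₀ (c 0) = expChart U₀ X₁
    rw [hc0]
  have hd : DifferentiableAt ℝ
      (fun (s : ℝ) (b : PBond (F.P K) 0) => (((fun s => expChart U₀ (c s)) s b : SU N) : Matrix (Fin N) (Fin N) ℂ)) 0 := by
    have h1 : DifferentiableAt ℝ (fun Y : PBond (F.P K) 0 → lieSU (Fin N) => coeField (expChart U₀ Y)) (c 0) :=
      ((contDiff_coeField_expChart U₀).differentiable (by simp)).differentiableAt
    exact h1.comp (0 : ℝ) hct.differentiableAt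
  have hcs : Filter.Tendsto c (𝓝 (0 : ℝ)) (𝓝 X₁) := by
    have h := hct.continuousAt
    rw [ContinuousAt, hc0] at h
    exact h
  have hfib : ∀ᶠ s in 𝓝 (0 : ℝ), AgreeOn 𝔹 (avgFamily (avOfRecord F N K) ((fun s => expChart U₀ (c s)) s)) W := by
    filter_upwards [hcf, hcs.eventually hlev] with s hs hl
    exact hl hs
  have hA : DifferentiableAt ℝ (fun Y : PBond (F.P K) 0 → lieSU (Fin N) => wilsonAction4 (expChart U₀ Y)) X₁ :=
    ((contDiff_wilsonAction4_expChart U₀).differentiable (by simp)).differentiableAt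
  have hA' : HasFDerivAt (fun Y : PBond (F.P K) 0 → lieSU (Fin N) => wilsonAction4 (expChart U₀ Y))
      (fderiv ℝ (fun Y : PBond (F.P K) 0 → lieSU (Fin N) => wilsonAction4 (expChart U₀ Y)) X₁) (c 0) := by
    rw [hc0]; exact hA.hasFDerivAt
  have hcomp : HasDerivAt (fun s => wilsonAction4 ((fun s => expChart U₀ (c s)) s))
      (fderiv ℝ (fun Y : PBond (F.P K) 0 → lieSU (Fin N) => wilsonAction4 (expChart U₀ Y)) X₁ t) 0 :=
    hA'.comp_hasDerivAt (0 : ℝ) hct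
  exact hcrit (fun s => expChart U₀ (c s)) hγ0 hd hfib _ hcomp

/-- **THE GLOBAL LETTER IMPLIES THE LOCAL ONE** (bookkeeping: v1.1 is WEAKER). [cite: Balaban1985Variational, (82)–(83) p.290 (bookkeeping)] -/
theorem eventually_levelSet_of_forall {N : ℕ} [NeZero N] {K : ℕ} {𝔹 : DetSet (F.P K)} {W : MSField (F.P K) (SU N)} (U₀ : GaugeField (F.P K) 0 (SU N))
    {V : Type*} {Ψ : (PBond (F.P K) 0 → lieSU (Fin N)) → V} {X₁ : PBond (F.P K) 0 → lieSU (Fin N)}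
    (hlev : ∀ Y, Ψ Y = Ψ X₁ → AgreeOn 𝔹 (avgFamily (avOfRecord F N K) (expChart U₀ Y)) W) :
    ∀ᶠ Y in 𝓝 X₁, Ψ Y = Ψ X₁ → AgreeOn 𝔹 (avgFamily (avOfRecord F N K) (expChart U₀ Y)) W :=
  Filter.Eventually.of_forall hlev

/-- **FROM A PRODUCT NEIGHBOURHOOD TO «NEAR EVERY MEMBER»** (topology bookkeeping for suppliers of the local letter): a property holding for `(Y, g)` near `(X g₀, g₀)` holds, for `g`
near `g₀`, for all `Y` near `X g` — `X` continuous at `g₀`. [folklore] -/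
theorem eventually_nhds_eventually_nhds_of_prod {E G : Type*} [TopologicalSpace E] [TopologicalSpace G] {P : E → G → Prop} {X : G → E} {g₀ : G}
    (h : ∀ᶠ q in 𝓝 (X g₀, g₀), P q.1 q.2) (hX : ContinuousAt X g₀) : ∀ᶠ g in 𝓝 g₀, ∀ᶠ Y in 𝓝 (X g), P Y g := by
  obtain ⟨u, v, hu, hxu, hv, hgv, huv⟩ := mem_nhds_prod_iff'.1 h
  have h1 : ∀ᶠ g in 𝓝 g₀, X g ∈ u := hX.preimage_mem_nhds (hu.mem_nhds hxu)
  have h2 : ∀ᶠ g in 𝓝 g₀, g ∈ v := hv.mem_nhds hgv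
  filter_upwards [h1, h2] with g hg1 hg2
  filter_upwards [hu.mem_nhds hg1] with Y hY
  exact huv (Set.mk_mem_prod hY hg2)

/-- **THE FLAT CRITICAL-ON-FIBRE EXP-CHART FAMILY token, LOCAL (v1.1) EDITION** (DISPLAYED — asserts nothing): as ✓`FlatCritOnFibreExpChartFamilyAt` but with the level-set clause of the
submersion letter only NEAR each member: `∀ᶠ Y in 𝓝 (X B), Ψ Y = Ψ (X B) → expChart 1 Y ∈ 𝔅(𝐁, W B)` — inhabitable by a logarithmic chart of the averages (n07-e's `msChart`).
[cite: Balaban1985Variational, Thm 1 p.279, (5)–(6) p.278, (82)–(83) p.290, Prop. 8 p.304; Balaban1985RegularSpaces, (1.113)–(1.114) pp.95–97; Balaban1988Convergent, (2.10)–(2.12) p.256] -/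
def FlatCritOnFibreExpChartFamilyNearAt (k K : ℕ) {V : Type*} [NormedAddCommGroup V] [NormedSpace ℝ V] (𝔹 : DetSet (F.P K))
    (W : (Fin (F.P K).d → Site (F.P K) (k + 1) → θ.Vβ) → MSField (F.P K) (SU 2))
    (X : (Fin (F.P K).d → Site (F.P K) (k + 1) → θ.Vβ) → PBond (F.P K) 0 → lieSU (Fin 2))
    (Ψ : (PBond (F.P K) 0 → lieSU (Fin 2)) → V) (datum : (Fin (F.P K).d → Site (F.P K) (k + 1) → θ.Vβ) → V) : Prop :=
  letI := θ.instVβ₁; letI := θ.instVβ₂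
  X 0 = 0 ∧ DifferentiableAt ℝ X 0 ∧ DifferentiableAt ℝ (fun Y => fderiv ℝ Ψ Y) 0 ∧
    (∀ᶠ B in 𝓝 (0 : Fin (F.P K).d → Site (F.P K) (k + 1) → θ.Vβ),
      IsCritOnFibre F 2 K 𝔹 (W B) (expChart (1 : GaugeField (F.P K) 0 (SU 2)) (X B))) ∧
    (∀ᶠ B in 𝓝 (0 : Fin (F.P K).d → Site (F.P K) (k + 1) → θ.Vβ),
      HasStrictFDerivAt Ψ (fderiv ℝ Ψ (X B)) (X B) ∧
        ((fderiv ℝ Ψ (X B) : (PBond (F.P K) 0 → lieSU (Fin 2)) →ₗ[ℝ] V).range = ⊤) ∧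
        ∀ᶠ Y in 𝓝 (X B), Ψ Y = Ψ (X B) → AgreeOn 𝔹 (avgFamily (avOfRecord F 2 K) (expChart (1 : GaugeField (F.P K) 0 (SU 2)) Y)) (W B)) ∧
    (∀ᶠ B in 𝓝 (0 : Fin (F.P K).d → Site (F.P K) (k + 1) → θ.Vβ), Ψ (X B) = datum B)

/-- The global-letter token implies the local-letter token (v1.1 is weaker). [cite: Balaban1985Variational, (82)–(83) p.290 (bookkeeping)] -/
theorem flatCritOnFibreExpChartFamilyNearAt_of_global (k K : ℕ) {V : Type*} [NormedAddCommGroup V] [NormedSpace ℝ V]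
    {𝔹 : DetSet (F.P K)} {W : (Fin (F.P K).d → Site (F.P K) (k + 1) → θ.Vβ) → MSField (F.P K) (SU 2)}
    {X : (Fin (F.P K).d → Site (F.P K) (k + 1) → θ.Vβ) → PBond (F.P K) 0 → lieSU (Fin 2)}
    {Ψ : (PBond (F.P K) 0 → lieSU (Fin 2)) → V} {datum : (Fin (F.P K).d → Site (F.P K) (k + 1) → θ.Vβ) → V}
    (h : FlatCritOnFibreExpChartFamilyAt F θ k K 𝔹 W X Ψ datum) : FlatCritOnFibreExpChartFamilyNearAt F θ k K 𝔹 W X Ψ datum := by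
  letI := θ.instVβ₁; letI := θ.instVβ₂
  obtain ⟨hX₀, hXd, hΨ₂d, hco, hchart, hfib⟩ := h
  refine ⟨hX₀, hXd, hΨ₂d, hco, ?_, hfib⟩
  filter_upwards [hchart] with B hB
  exact ⟨hB.1, hB.2.1, Filter.Eventually.of_forall hB.2.2⟩

/-- ★★ **THE LOCAL-LETTER TOKEN IMPLIES THE TANGENT-FORM TOKEN** (N12 §3 v1.1 + «onto at `0`»). [cite: Balaban1985Variational, (82)–(83) p.290, Prop. 8 p.304] -/
theorem flatCriticalExpChartFamilyAt_of_critOnFibreNear (k K : ℕ) {V : Type*} [NormedAddCommGroup V] [NormedSpace ℝ V] [FiniteDimensional ℝ V]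
    {𝔹 : DetSet (F.P K)} {W : (Fin (F.P K).d → Site (F.P K) (k + 1) → θ.Vβ) → MSField (F.P K) (SU 2)}
    {X : (Fin (F.P K).d → Site (F.P K) (k + 1) → θ.Vβ) → PBond (F.P K) 0 → lieSU (Fin 2)}
    {Ψ : (PBond (F.P K) 0 → lieSU (Fin 2)) → V} {datum : (Fin (F.P K).d → Site (F.P K) (k + 1) → θ.Vβ) → V}
    (h : FlatCritOnFibreExpChartFamilyNearAt F θ k K 𝔹 W X Ψ datum) : FlatCriticalExpChartFamilyAt F θ k K X Ψ datum := by
  letI := θ.instVβ₁; letI := θ.instVβ₂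
  obtain ⟨hX₀, hXd, hΨ₂d, hco, hchart, hfib⟩ := h
  have h0 := (hchart.self_of_nhds).1
  have hr := (hchart.self_of_nhds).2.1
  rw [hX₀] at h0 hr
  have hΨd : DifferentiableAt ℝ Ψ 0 := h0.hasFDerivAt.differentiableAt
  have hsurj : Function.Surjective (fderiv ℝ Ψ 0) := by
    intro y
    have hy : y ∈ ((fderiv ℝ Ψ 0 : (PBond (F.P K) 0 → lieSU (Fin 2)) →ₗ[ℝ] V)).range := by rw [hr]; trivial
    obtain ⟨x, hx⟩ := hy
    exact ⟨x, hx⟩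
  have hcrit : ∀ᶠ B in 𝓝 (0 : Fin (F.P K).d → Site (F.P K) (k + 1) → θ.Vβ), ∀ t, fderiv ℝ Ψ (X B) t = 0 →
      fderiv ℝ (fun Y : PBond (F.P K) 0 → lieSU (Fin 2) => wilsonAction4 (expChart (1 : GaugeField (F.P K) 0 (SU 2)) Y)) (X B) t = 0 := by
    filter_upwards [hco, hchart] with g hm hc t ht
    exact fderiv_wilsonAction4_expChart_apply_eq_zero_of_isCritOnFibre_levelNear F (1 : GaugeField (F.P K) 0 (SU 2)) hc.1 hc.2.1 hc.2.2 hm ht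
  exact ⟨hX₀, hXd, hΨd, hΨ₂d, hsurj, hcrit, hfib⟩

/-- ★★★ **THE SOCKET PLUGGED AT THE LOCAL-LETTER TOKEN**: members critical on their fibres + the LOCAL submersion letter + the two flat dictionaries ⟹ `ChartResponseWeaklyCriticalAt` for
`B ↦ expChart 1 (X B)`, all `a l`. [cite: Balaban1985Variational, (176)–(178) p.306, (82)–(83) p.290, Prop. 8 p.304; Balaban1984PropagatorsII, (2.35) p.228] -/
theorem chartResponseWeaklyCritical_of_critOnFibreNearFamily (k K : ℕ) {V : Type*} [NormedAddCommGroup V] [NormedSpace ℝ V] [FiniteDimensional ℝ V]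
    (𝔹 : DetSet (F.P K)) (W : (Fin (F.P K).d → Site (F.P K) (k + 1) → θ.Vβ) → MSField (F.P K) (SU 2))
    (X : (Fin (F.P K).d → Site (F.P K) (k + 1) → θ.Vβ) → PBond (F.P K) 0 → lieSU (Fin 2))
    (Ψ : (PBond (F.P K) 0 → lieSU (Fin 2)) → V) (datum : (Fin (F.P K).d → Site (F.P K) (k + 1) → θ.Vβ) → V)
    (hfam : FlatCritOnFibreExpChartFamilyNearAt F θ k K 𝔹 W X Ψ datum) (Jcrit : FlatCritDictionary F k K Ψ) (Jcons : FlatConsDictionary F θ k K Ψ datum)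
    (a : θ.ιβ) (l : RespLabel F k K) :
    ChartResponseWeaklyCriticalAt F θ k K (fun B => expChart (1 : GaugeField (F.P K) 0 (SU 2)) (X B)) a l :=
  chartResponseWeaklyCritical_of_flatCriticalExpChartFamily F θ k K X Ψ datum
    (flatCriticalExpChartFamilyAt_of_critOnFibreNear F θ k K hfam) Jcrit Jcons a l

/-- ★★★ **ROOTED RECEIPTS FROM THE TANGENT-FORM TOKEN** (the most general edition of §4c's docking: ANY factorising chart `U`, (s-exp), the FLAT token, the two dictionaries) — both of-record
editions (global ∕ local letter) factor through it. [cite: Balaban1985Variational, (19) p.281, (174) p.305, (177)–(182) p.306–307; Balaban1987RG1, (1.1) p.260, (2.3)–(2.4) p.265] -/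
theorem rootedReceipts_of_flatExpChartFamily (k K : ℕ) (hk : k + 1 ≤ (F.P K).m + (F.P K).K)
    (U : (Fin (F.P K).d → Site (F.P K) (k + 1) → θ.Vβ) → GaugeField (F.P K) 0 (SU 2)) (hfac : RootFactorAt F θ k K U)
    {V : Type*} [NormedAddCommGroup V] [NormedSpace ℝ V] [FiniteDimensional ℝ V]
    (X : (Fin (F.P K).d → Site (F.P K) (k + 1) → θ.Vβ) → PBond (F.P K) 0 → lieSU (Fin 2))
    (Ψ : (PBond (F.P K) 0 → lieSU (Fin 2)) → V) (datum : (Fin (F.P K).d → Site (F.P K) (k + 1) → θ.Vβ) → V)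
    (hUX : letI := θ.instVβ₁; letI := θ.instVβ₂;
      U =ᶠ[𝓝 (0 : Fin (F.P K).d → Site (F.P K) (k + 1) → θ.Vβ)] fun B => expChart (1 : GaugeField (F.P K) 0 (SU 2)) (X B))
    (hfam : FlatCriticalExpChartFamilyAt F θ k K X Ψ datum) (Jcrit : FlatCritDictionary F k K Ψ) (Jcons : FlatConsDictionary F θ k K Ψ datum)
    (a : θ.ιβ) (l : RespLabel F k K) :
    RootedResponseCriticalModGaugeAt F θ k K a l ∧ RootedResponseOrbitAt F θ k K a l ∧
      RootedResponseInvCriticalAt F θ k K a l ∧ RootedResponseConstraintModGaugeAt F θ k K a l := by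
  letI := θ.instVβ₁; letI := θ.instVβ₂
  have hfac' : RootFactorAt F θ k K (fun B => expChart (1 : GaugeField (F.P K) 0 (SU 2)) (X B)) := rootFactorAt_congr F θ k K hfac hUX
  have hreg : ChartRegAt F θ k K (fun B => expChart (1 : GaugeField (F.P K) 0 (SU 2)) (X B)) := chartRegAt_expChart F θ k K hfam.1 hfam.2.1
  exact rootedReceipts_of_chart F θ k K hk _ hfac' hreg a l
    (chartResponseWeaklyCritical_of_flatCriticalExpChartFamily F θ k K X Ψ datum hfam Jcrit Jcons a l)

/-- ★★★ **ROOTED RECEIPTS + `TokP9reg` AT def-Y's CHART ON THE ONE-SCALE FIBRE, LOCAL SUBMERSION LETTER, MINIMALITY FROM THE KNIT** — the v1.1 edition of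
`rootedReceipts_of_tokens_atScale`: the `Ψ`-letter is «strict derivative onto at every member near `0` + level set in the fibre NEAR the member», the form n07-e's canonical chart has.
DISPLAYED: KNIT tokens + `RegimeTok` + domain letter; (s-exp); `X 0 = 0`, `ContDiffAt ℝ 2 X 0`; the local `Ψ`-letter with `DΨ` differentiable at `0`; the datum clause; (J-crit′); (J-cons′).
CONDITIONAL; nothing of [15] asserted. [cite: Balaban1985Variational, Thm 1 p.279, Prop. 6 p.295, (82)–(83) p.290, Prop. 8 p.304, Prop. 9 p.309, (174) p.305, (177)–(182) p.306–307; Balaban1985RegularSpaces, (1.113)–(1.114) pp.95–97; Balaban1987RG1, (0.21) p.256, (1.1)–(1.2) p.260, (2.3)–(2.4) p.265; Balaban1988Convergent, (2.10)–(2.12) p.256] -/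
theorem rootedReceipts_of_tokens_atScale_near {𝒴 𝒵 : Type} [NormedAddCommGroup 𝒴] [NormedSpace ℂ 𝒴] [CompleteSpace 𝒴] [NormedAddCommGroup 𝒵] [NormedSpace ℂ 𝒵]
    (k K : ℕ) (hk : k + 1 ≤ (F.P K).m + (F.P K).K) (S : BgScheme F 2 𝒴 𝒵 K (k + 1))
    (hR : S.RegimeTok) (Kc : GaugeField (F.P K) (k + 1) (SU 2) → Set 𝒴)
    (range : ∀ V ∈ S.dom, ∀ A ∈ Kc V, S.chart V A ∈ bgReg F 2 K (k + 1) θ.εbg ∧ Averaging.iter (avOfRecord F 2 K) (k + 1) (S.chart V A) = V)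
    (covers : ∀ V ∈ S.dom, ∀ U : GaugeField (F.P K) 0 (SU 2), U ∈ bgReg F 2 K (k + 1) θ.εbg →
      Averaging.iter (avOfRecord F 2 K) (k + 1) U = V → ∃ A ∈ Kc V, OrbitRel (k + 1) (S.chart V A) U)
    (sol_of_isMinOn : ∀ V ∈ S.dom, ∀ A ∈ Kc V, IsMinOn (wilsonAction4 ∘ S.chart V) (Kc V) A →
      ‖A‖ ≤ S.ε₄ ∧ mapT (S.𝒢 V) 0 (S.W V) (S.J V) (S.𝔄 V) A = A)
    (star_mem : ∀ V ∈ S.dom, S.sol V ∈ Kc V) (star_isMinOn : ∀ V ∈ S.dom, IsMinOn (wilsonAction4 ∘ S.chart V) (Kc V) (S.sol V))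
    (hdom : letI := θ.instVβ₁; letI := θ.instVβ₂;
      ∀ᶠ B in 𝓝 (0 : Fin (F.P K).d → Site (F.P K) (k + 1) → θ.Vβ), unitField F θ k K B ∈ S.dom)
    {V : Type*} [NormedAddCommGroup V] [NormedSpace ℝ V] [FiniteDimensional ℝ V]
    (W : (Fin (F.P K).d → Site (F.P K) (k + 1) → θ.Vβ) → MSField (F.P K) (SU 2)) (hW : ∀ B, W B (k + 1) = unitField F θ k K B)
    (X : (Fin (F.P K).d → Site (F.P K) (k + 1) → θ.Vβ) → PBond (F.P K) 0 → lieSU (Fin 2))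
    (Ψ : (PBond (F.P K) 0 → lieSU (Fin 2)) → V) (datum : (Fin (F.P K).d → Site (F.P K) (k + 1) → θ.Vβ) → V)
    (hSX : letI := θ.instVβ₁; letI := θ.instVβ₂;
      (fun B => S.chartCfg (unitField F θ k K B)) =ᶠ[𝓝 (0 : Fin (F.P K).d → Site (F.P K) (k + 1) → θ.Vβ)]
        fun B => expChart (1 : GaugeField (F.P K) 0 (SU 2)) (X B))
    (hX₀ : letI := θ.instVβ₁; letI := θ.instVβ₂; X 0 = 0) (hXc : letI := θ.instVβ₁; letI := θ.instVβ₂; ContDiffAt ℝ 2 X 0)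
    (hΨd : DifferentiableAt ℝ (fun Y => fderiv ℝ Ψ Y) 0)
    (hsub : letI := θ.instVβ₁; letI := θ.instVβ₂;
      ∀ᶠ B in 𝓝 (0 : Fin (F.P K).d → Site (F.P K) (k + 1) → θ.Vβ),
        HasStrictFDerivAt Ψ (fderiv ℝ Ψ (X B)) (X B) ∧
          ((fderiv ℝ Ψ (X B) : (PBond (F.P K) 0 → lieSU (Fin 2)) →ₗ[ℝ] V).range = ⊤) ∧
          ∀ᶠ Y in 𝓝 (X B), Ψ Y = Ψ (X B) →
            AgreeOn (atScale (k + 1)) (avgFamily (avOfRecord F 2 K) (expChart (1 : GaugeField (F.P K) 0 (SU 2)) Y)) (W B))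
    (hdat : letI := θ.instVβ₁; letI := θ.instVβ₂;
      ∀ᶠ B in 𝓝 (0 : Fin (F.P K).d → Site (F.P K) (k + 1) → θ.Vβ), Ψ (X B) = datum B)
    (Jcrit : FlatCritDictionary F k K Ψ) (Jcons : FlatConsDictionary F θ k K Ψ datum) :
    (∀ (a : θ.ιβ) (l : RespLabel F k K),
      RootedResponseCriticalModGaugeAt F θ k K a l ∧ RootedResponseOrbitAt F θ k K a l ∧
        RootedResponseInvCriticalAt F θ k K a l ∧ RootedResponseConstraintModGaugeAt F θ k K a l) ∧
    letI := θ.instVβ₁; letI := θ.instVβ₂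
    ContDiffAt ℝ 2 (fun B : Fin (F.P K).d → Site (F.P K) (k + 1) → θ.Vβ =>
      fun (b : PBond (F.P K) 0) (i i' : Fin 2) => ((recordBgField F θ k K B b : SU 2) : Matrix (Fin 2) (Fin 2) ℂ) i i') 0 := by
  letI := θ.instVβ₁; letI := θ.instVβ₂
  have hfac := rootFactorAt_of_tokens_chart F θ k K hk S hR Kc range covers sol_of_isMinOn star_mem star_isMinOn hdom
  have hco := eventually_isCritOnFibre_expChart_of_tokens F θ k K S Kc range covers star_mem star_isMinOn hdom W hW X hSX
  have hnear : FlatCritOnFibreExpChartFamilyNearAt F θ k K (atScale (k + 1)) W X Ψ datum :=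
    ⟨hX₀, hXc.differentiableAt (by norm_num), hΨd, hco, hsub, hdat⟩
  exact ⟨fun a l => rootedReceipts_of_flatExpChartFamily F θ k K hk _ hfac X Ψ datum hSX
      (flatCriticalExpChartFamilyAt_of_critOnFibreNear F θ k K hnear) Jcrit Jcons a l,
    tokP9reg_of_expChartFamily F θ k K _ hfac X hSX hXc⟩

end NearEdition

end Summit.QuantumFields.YangMills.Theorems.K0AxCtabUniq

end
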